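import Summits.AtomisticToContinuum.BoseEinsteinCondensation.Theorems.BECInsertionCorrectorCorrectorClosureFirstOrderInput
import Summits.AtomisticToContinuum.BoseEinsteinCondensation.Theorems.BECInsertionCorrectorCorrectorClosureDriftModeQuadratures
import Summits.AtomisticToContinuum.BoseEinsteinCondensation.Theorems.BECConjugateDominationHardCoreExtensionGroundStateRegularity
import HarnessLib

/-!
# Line `insertion-mode-gaussian-domination`, aux `driftMode_bound_of_staticResponseBound` — K1 and the f-sum rule bound
# BOTH quadratures of the bath drift mode of the true Feynman–Kac bath ground state (crux
# `BECInsertionCorrector.CorrectorClosure`, item stmt-AtomisticToContinuum-12058; supports, does not close, the item)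

Glue of the landed S2 (`stub_firstOrderInput`, p141534: K1 ⇒ `‖Σcos‖²₋₁ + ‖Σsin‖²₋₁ ≤ B₁N/max(ρ'a, p²)` for the FK bath
ground state `Θ₀`) with the drift-mode bounds (`driftMode_cos_hMinusOneSqW_le`, `driftMode_sin_hMinusOneSqW_le`,
p163940/p164123): given `StaticResponseBound`, for every repulsive finite-range `v` there are `B₁, ρ₂ > 0` such that for
`0 < ρ < ρ₂`, all large `N`, the box `L = sideLength ρ (N+1)` (`v^per` bounded), the continuous positive FK bath ground
state `Θ₀` and every `n ≠ 0`, BOTH drift quadratures `(Σⱼ cos θⱼ p·∇ⱼΘ₀)/Θ₀`, `(Σⱼ sin θⱼ p·∇ⱼΘ₀)/Θ₀` have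
`‖·‖²₋₁ ≤ ¼(|p|²√b + √(N|p|²∫Θ₀²))²`, `b = B₁N/max(ρ'a, p²)` — the K1-fed budget of the bath DRIFT source of the
pair-dressed hole equation (heart dossier `Cruxes/CorrectorClosure/Lines/insertion-mode-gaussian-domination-heart.md` §2,
table row 2): after the recoil resolvent `p⁻⁴` and the factor `ρ/L³` this is the `Bρ/p⁴` shape that C⁺
(`stub_remainderDomination`) allows. `Θ₀ ∈ C¹` by `stub_periodicGroundStateRegularity`.
References (shape only): C. Kipnis, S. R. S. Varadhan, Comm. Math. Phys. 104 (1986), (1.14).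
-/

noncomputable section

namespace Summit.AtomisticToContinuum.BoseEinsteinCondensation.Theorems.CorrectorClosure.InsertionModeGaussianDomination

open MeasureTheory Filter
open scoped ENNReal NNReal BigOperators
open Literature.MathematicalPhysics.QuantumManyBody.BoseGas
open Summit.AtomisticToContinuum.BoseEinsteinCondensation.Theses.BECInsertionCorrector
open Summit.AtomisticToContinuum.BoseEinsteinCondensation.Theorems.CorrectorClosure.Negative (sideLength_succ_pos)
open Summit.AtomisticToContinuum.BoseEinsteinCondensation.Cruxes.HardCoreExtension.ThirdLawCurrentFloor
  (stub_periodicGroundStateRegularity)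

/-- **Aux `driftMode_bound_of_staticResponseBound` — K1 + f-sum bound both drift quadratures of the FK bath ground
state.** Given `StaticResponseBound`, for every repulsive finite-range `v`: `∃ B₁ ρ₂ > 0`, `∀ ρ ∈ (0, ρ₂)`, `∀ᶠ N`,
box `L = sideLength ρ (N+1)` with `v^per` bounded, FK bath ground state `Θ₀ > 0` continuous, `n ≠ 0`:
`‖(Σⱼ cos θⱼ p·∇ⱼΘ₀)/Θ₀‖²₋₁, ‖(Σⱼ sin θⱼ p·∇ⱼΘ₀)/Θ₀‖²₋₁ ≤ ¼(|p|²√b + √(N|p|²∫Θ₀²))²`, `b = B₁N/max(ρ'a, p²)`,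
`|p|² = Σ_k (2πn_k/L)²`. [cite: KipnisVaradhan1986, (1.14)] -/
theorem driftMode_bound_of_staticResponseBound (hK1 : StaticResponseBound) (v : ℝ → ℝ≥0∞)
    (hv : IsRepulsiveFiniteRange v) :
    ∃ B₁ : ℝ, 0 < B₁ ∧ ∃ ρ₂ : ℝ, 0 < ρ₂ ∧ ∀ ρ : ℝ, 0 < ρ → ρ < ρ₂ → ∀ᶠ N : ℕ in atTop,
      ∀ (L : ℝ), L = sideLength ρ (N + 1) → (∃ C : ℝ≥0, ∀ x, periodizedPotential v L x ≤ C) →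
      ∀ (Θ₀ : Config N → ℝ), IsPeriodicGroundStateFK v L Θ₀ → Continuous Θ₀ → (∀ X, 0 < Θ₀ X) →
      ∀ (n : Fin 3 → ℤ), n ≠ 0 →
        hMinusOneSqW L Θ₀ (fun X =>
            (∑ j : Fin N, Real.cos (2 * Real.pi / L * ∑ i, (n i : ℝ) * X j i) *
              ∑ k : Fin 3, 2 * Real.pi / L * (n k : ℝ) * pderiv j k Θ₀ X) / Θ₀ X) ≤
          ENNReal.ofReal
            (((∑ k : Fin 3, (2 * Real.pi / L * (n k : ℝ)) ^ 2) *
                  Real.sqrt (B₁ * N / max ((N : ℝ) / L ^ 3 * (scatteringLength v).toReal)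
                    ((2 * Real.pi / L) ^ 2 * ∑ i, (n i : ℝ) ^ 2)) +
                Real.sqrt (N * (∑ k : Fin 3, (2 * Real.pi / L * (n k : ℝ)) ^ 2) *
                  ∫ X in cellN N L, Θ₀ X ^ 2)) ^ 2 / 4) ∧
        hMinusOneSqW L Θ₀ (fun X =>
            (∑ j : Fin N, Real.sin (2 * Real.pi / L * ∑ i, (n i : ℝ) * X j i) *
              ∑ k : Fin 3, 2 * Real.pi / L * (n k : ℝ) * pderiv j k Θ₀ X) / Θ₀ X) ≤
          ENNReal.ofReal
            (((∑ k : Fin 3, (2 * Real.pi / L * (n k : ℝ)) ^ 2) *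
                  Real.sqrt (B₁ * N / max ((N : ℝ) / L ^ 3 * (scatteringLength v).toReal)
                    ((2 * Real.pi / L) ^ 2 * ∑ i, (n i : ℝ) ^ 2)) +
                Real.sqrt (N * (∑ k : Fin 3, (2 * Real.pi / L * (n k : ℝ)) ^ 2) *
                  ∫ X in cellN N L, Θ₀ X ^ 2)) ^ 2 / 4) := by
  obtain ⟨B₁, hB₁, ρ₂, hρ₂, hFO⟩ := stub_firstOrderInput hK1 v hv
  refine ⟨B₁, hB₁, ρ₂, hρ₂, fun ρ hρ hρ₂' => ?_⟩
  filter_upwards [hFO ρ hρ hρ₂', eventually_ge_atTop 1] with N hFON hN1 L hL_def hb Θ₀ hΘ hΘc hΘp n hn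
  have hL : 0 < L := by rw [hL_def]; exact sideLength_succ_pos hρ N
  have hsum := hFON L hL_def hb Θ₀ hΘ hΘc hΘp n hn
  -- the common real bound `b ≥ 0` and the two single-quadrature hypotheses
  set b : ℝ := B₁ * N / max ((N : ℝ) / L ^ 3 * (scatteringLength v).toReal)
      ((2 * Real.pi / L) ^ 2 * ∑ i, (n i : ℝ) ^ 2) with hb_def
  have hb0 : 0 ≤ b := by
    rw [hb_def]
    exact div_nonneg (mul_nonneg hB₁.le (Nat.cast_nonneg N))
      (le_max_of_le_right (mul_nonneg (sq_nonneg _) (Finset.sum_nonneg fun i _ => sq_nonneg _)))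
  have hCos : hMinusOneSqW L Θ₀ (fun X => ∑ j, Real.cos (2 * Real.pi / L * ∑ i, (n i : ℝ) * X j i)) ≤
      ENNReal.ofReal b := le_trans le_self_add hsum
  have hSin : hMinusOneSqW L Θ₀ (fun X => ∑ j, Real.sin (2 * Real.pi / L * ∑ i, (n i : ℝ) * X j i)) ≤
      ENNReal.ofReal b := le_trans le_add_self hsum
  -- `Θ₀ ∈ C¹` and lattice periodic
  have hΘC1 : ContDiff ℝ 1 Θ₀ := stub_periodicGroundStateRegularity N L v hN1 hL hv.1 hb Θ₀ hΘ
  have hΘper : IsLatticePeriodic L Θ₀ := hΘ.periodic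
  exact ⟨driftMode_cos_hMinusOneSqW_le hL hΘC1 hΘper n hb0 hSin,
    driftMode_sin_hMinusOneSqW_le hL hΘC1 hΘper n hb0 hCos⟩

end Summit.AtomisticToContinuum.BoseEinsteinCondensation.Theorems.CorrectorClosure.InsertionModeGaussianDomination

end
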